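import Literature.Probability.LatticeModels.KCPrimitiveFrozen
import Literature.Probability.LatticeModels.WeakBeurlingEstimate
import Literature.Probability.Percolation.LatticeCycleSpace
import HarnessLib

/-!
# The frozen boundary of a simply connected lattice domain is plaquette-connected, and the Kadanoff–Ceva primitive is constant on it

Topic `Literature/Probability/LatticeModels`. Chelkak–Hongler–Izyurov 2015, Prop. 3.6 (ii): the
discrete primitive `H = Re ∫ F²` of the spinor observable satisfies the Dirichlet condition
`H° ≡ 0` on the boundary faces of the (connected, simply connected) discrete domain. In the tree's
Kadanoff–Ceva rendering (`IsingDisorderLaplacian.lean`, `KCPrimitiveFrozen.lean`) the LOCAL form is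
proved — `Hw` takes equal values at two frozen corners of one plaquette of the cut system
(`IsKCPrimitive.hw_eq_of_frozen_corners`), hence along chains of `FrozenLinked` sites — and the
GLOBAL normalisation ("`Hw|_∂ ≡ const`", listed as NOT done in `IsingDisorderLaplacian.lean`) was
reduced there to a connectivity statement about the frozen boundary. This file proves that
statement, by the graph-theoretic (cycle space) method of Á. Timár, *Boundary-connectivity via graph
theory*, Proc. AMS 141 (2013), Lemma 1 and Theorem 2 (whose `ℤ²` input, "the unit squares generate
the even edge sets", is `exists_eq_xorSum_unitSq` of `Percolation/LatticeCycleSpace.lean`):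

* `BLink Λ P a b` — `a, b ∉ Λ` are corners of a common plaquette of `P` (a symmetric form of
  `FrozenLinked`, `BLink.frozenLinked`);
* **`reflTransGen_bLink_touch`** — if the free sites `Λ ⊆ ℤ²` induce a preconnected subgraph of
  `ℤ²` and so does their complement (the lattice form of "connected and simply connected"), then ANY
  two frozen corners of plaquettes touching `Λ` are joined by a chain of such links through
  plaquettes touching `Λ`. Proof (Timár's parity argument, adapted so that the linking plaquettes
  touch `Λ`): if the class `T` of one frozen corner missed another, take boundary bonds `u₁w₁`,
  `u₂w₂` (`uᵢ ∈ Λ`, `wᵢ ∉ Λ`, `w₂ ∈ T ∌ w₁`), a lattice path from `w₁` to `w₂` off `Λ` and one from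
  `u₂` to `u₁` inside `Λ`; with the bond `w₁u₁` they form an even edge set, hence a mod-2 sum of unit
  squares; the set `E₂` of bonds from `Λ` into `T` meets it in exactly one bond (`u₂w₂`), but meets
  every unit square in an even number of bonds, because the frozen corners of a plaquette touching
  `Λ` are pairwise linked (so all in `T` or all outside) and a 4-cycle changes between `Λ` and its
  complement an even number of times — a contradiction;
* **`reflTransGen_bLink_fill`** — the same for the frozen corners of the FILLED plaquette set
  `fillFinset (touchPlaquettes Λ)` on which `exists_kcCuts_primitive` builds the cut system (a filled,
  non-touching plaquette is joined to a touching one straight upwards through filled plaquettes);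
* **`IsKCPrimitive.hw_eq_of_preconnected`** — consequently the Kadanoff–Ceva primitive `Hw` of
  CHI15 Prop. 3.6 takes ONE value on all frozen corners of the cut plaquettes: the global Dirichlet
  normalisation of CHI15 Prop. 3.6 (ii) for connected, simply connected lattice domains;
* `induce_compl_preconnected_of_holeFree` — the hypothesis on the complement from hole-freeness
  (`HoleFree`, the form used by `exists_kcCuts_primitive_mesh`) for finite `Λ`.

Everything is proved; no named fact.

## References

* Á. Timár, *Boundary-connectivity via graph theory*, Proc. Amer. Math. Soc. 141 (2013) 475–480 =
  arXiv:0711.1713, Lemma 1, Theorem 2 and the remark before it — `Timar2013`.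
* D. Chelkak, C. Hongler, K. Izyurov, Ann. of Math. 181 (2015) = arXiv:1202.2838, §2.1 (discrete
  domains are connected and simply connected), Prop. 3.6 (ii) — `ChelkakHonglerIzyurovAnnals2015`.
-/

noncomputable section

namespace Literature.Probability.LatticeModels

open Finset SimpleGraph Relation
open scoped symmDiff
open Literature.Probability.Percolation (OddDeg IsEulerian xorSum unitSq sqWalk ex ey mem_xorSum_iff
  xorSum_empty xorSum_insert oddDeg_symmDiff_iff oddDeg_edgeParity_iff odd_card_symmDiff_iff
  exists_eq_xorSum_unitSq mem_edges_of_mem_edgeParity not_oddDeg_empty)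

/-! ### Preliminaries: steps, walks inside a set, mod-2 edge sets -/

section Prelim

/-- A plaquette touches `Λ` iff one of its four corners is in `Λ`. [cite: ChelkakHonglerIzyurovAnnals2015, §2.1] -/
theorem mem_touchPlaquettes_iff_corner {Λ : Finset (Site 2)} {p : Site 2} :
    p ∈ touchPlaquettes Λ ↔ ∃ i : Fin 4, p + cornerOff i ∈ Λ := by
  rw [mem_touchPlaquettes]
  constructor
  · rintro ⟨v, hv, k, hk⟩
    rw [faceAt_eq_iff] at hk
    exact ⟨k, hk ▸ hv⟩
  · rintro ⟨i, hi⟩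
    exact ⟨_, hi, i, faceAt_add_cornerOff p i⟩

/-- In a cyclic sequence of four truth values which is not constant there is a place where `true`
is followed by `false`. [folklore] -/
theorem exists_transition_fin4 {m : Fin 4 → Prop} {j k : Fin 4} (hj : m j) (hk : ¬ m k) :
    ∃ i, m i ∧ ¬ m (i + 1) := by
  by_contra h
  push Not at h
  have h1 := h j hj
  have h2 := h _ h1
  have h3 := h _ h2
  have hall : ∀ j k : Fin 4, k = j ∨ k = j + 1 ∨ k = j + 1 + 1 ∨ k = j + 1 + 1 + 1 := by decide
  rcases hall j k with rfl | rfl | rfl | rfl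
  · exact hk hj
  · exact hk h1
  · exact hk h2
  · exact hk h3

/-- A walk of `ℤ²` inside a set inducing a preconnected subgraph. [folklore] -/
theorem exists_walk_support_subset {S : Set (Site 2)} (hS : ((zdGraph 2).induce S).Preconnected)
    {x y : Site 2} (hx : x ∈ S) (hy : y ∈ S) :
    ∃ W : (zdGraph 2).Walk x y, ∀ z ∈ W.support, z ∈ S := by
  obtain ⟨Wi⟩ := hS ⟨x, hx⟩ ⟨y, hy⟩
  refine ⟨Wi.map (Embedding.induce S).toHom, fun z hz => ?_⟩
  erw [Walk.support_map, List.mem_map] at hz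
  obtain ⟨z', -, rfl⟩ := hz
  exact z'.2

variable {V : Type*} [DecidableEq V]

/-- The mod-2 edge set of a concatenation. [folklore] -/
theorem edgeParity_append {G : SimpleGraph V} :
    ∀ {a b c : V} (p : G.Walk a b) (q : G.Walk b c), (p.append q).edgeParity = p.edgeParity ∆ q.edgeParity
  | _, _, _, Walk.nil, q => by
    change q.edgeParity = (∅ : Finset (Sym2 V)) ∆ q.edgeParity
    ext e
    simp [Finset.mem_symmDiff]
  | a, _, _, Walk.cons (v := d) h p, q => by
    change ({s(a, d)} : Finset (Sym2 V)) ∆ (p.append q).edgeParity = (({s(a, d)} : Finset (Sym2 V)) ∆ p.edgeParity) ∆ q.edgeParity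
    rw [edgeParity_append p q, symmDiff_assoc]

omit [DecidableEq V] in
/-- Parity of the trace of a symmetric difference on a set. [folklore] -/
theorem odd_card_symmDiff_inter {α : Type*} [DecidableEq α] (A B E : Finset α) :
    Odd #((A ∆ B) ∩ E) ↔ (Odd #(A ∩ E) ↔ ¬ Odd #(B ∩ E)) := by
  rw [show (A ∆ B) ∩ E = (A ∩ E) ∆ (B ∩ E) from inf_symmDiff_distrib_right A B E]
  exact odd_card_symmDiff_iff _ _

omit [DecidableEq V] in
/-- Parity of the trace of a singleton. [folklore] -/
theorem odd_card_singleton_inter {α : Type*} [DecidableEq α] (a : α) (E : Finset α) :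
    Odd #(({a} : Finset α) ∩ E) ↔ a ∈ E := by
  by_cases h : a ∈ E
  · rw [Finset.singleton_inter_of_mem h]; simp [h]
  · rw [Finset.singleton_inter_of_notMem h]; simp [h]

omit [DecidableEq V] in
/-- A mod-2 sum of sets each meeting `E` evenly meets `E` evenly. [folklore] -/
theorem even_card_xorSum_inter {α ι : Type*} [DecidableEq α] [DecidableEq ι] (f : ι → Finset (Sym2 α))
    (E : Finset (Sym2 α)) (s : Finset ι) (h : ∀ i ∈ s, ¬ Odd #(f i ∩ E)) : ¬ Odd #(xorSum f s ∩ E) := by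
  induction s using Finset.induction_on with
  | empty => simp [xorSum_empty]
  | @insert i s hi ih =>
    rw [xorSum_insert f hi, odd_card_symmDiff_inter]
    have h1 := h i (Finset.mem_insert_self i s)
    have h2 := ih fun j hj => h j (Finset.mem_insert_of_mem hj)
    tauto

end Prelim

/-! ### Links between frozen sites through plaquettes -/

section Links

variable (Λ : Finset (Site 2))

/-- **Boundary link**: `a, b ∉ Λ` are corners of a common plaquette of `P`. [cite: ChelkakHonglerIzyurovAnnals2015, Prop. 3.6 (ii)] -/
def BLink (P : Set (Site 2)) (a b : Site 2) : Prop :=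
  a ∉ Λ ∧ b ∉ Λ ∧ ∃ p ∈ P, ∃ i j : Fin 4, a = p + cornerOff i ∧ b = p + cornerOff j

/-- A **frozen corner** of `P`: a site outside `Λ` which is a corner of a plaquette of `P`. [cite: ChelkakHonglerIzyurovAnnals2015, Prop. 3.6 (ii)] -/
def IsFrozenCorner (P : Set (Site 2)) (v : Site 2) : Prop :=
  v ∉ Λ ∧ ∃ p ∈ P, ∃ i : Fin 4, v = p + cornerOff i

variable {Λ}

/-- Links are symmetric. [folklore] -/
theorem BLink.symm {P : Set (Site 2)} {a b : Site 2} (h : BLink Λ P a b) : BLink Λ P b a := by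
  obtain ⟨ha, hb, p, hp, i, j, hi, hj⟩ := h
  exact ⟨hb, ha, p, hp, j, i, hj, hi⟩

/-- Links are monotone in the plaquette set. [folklore] -/
theorem BLink.mono {P Q : Set (Site 2)} (hPQ : P ⊆ Q) {a b : Site 2} (h : BLink Λ P a b) : BLink Λ Q a b := by
  obtain ⟨ha, hb, p, hp, i, j, hi, hj⟩ := h
  exact ⟨ha, hb, p, hPQ hp, i, j, hi, hj⟩

/-- A link is a `FrozenLinked` pair (`KCPrimitiveFrozen.lean`). [folklore] -/
theorem BLink.frozenLinked {P : Set (Site 2)} {a b : Site 2} (h : BLink Λ P a b) : FrozenLinked P a b := by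
  obtain ⟨-, -, p, hp, i, j, rfl, rfl⟩ := h
  exact ⟨i, j, by rwa [faceAt_add_cornerOff], by rw [faceAt_add_cornerOff, faceAt_add_cornerOff]⟩

/-- Chains of links are symmetric. [folklore] -/
theorem reflTransGen_bLink_symm {P : Set (Site 2)} {a b : Site 2} (h : ReflTransGen (BLink Λ P) a b) :
    ReflTransGen (BLink Λ P) b a := by
  induction h with
  | refl => exact ReflTransGen.refl
  | tail _ hbc ih => exact ReflTransGen.head hbc.symm ih

/-- Chains of links are monotone in the plaquette set. [folklore] -/
theorem reflTransGen_bLink_mono {P Q : Set (Site 2)} (hPQ : P ⊆ Q) {a b : Site 2} (h : ReflTransGen (BLink Λ P) a b) :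
    ReflTransGen (BLink Λ Q) a b := by
  induction h with
  | refl => exact ReflTransGen.refl
  | tail _ hbc ih => exact ih.tail (hbc.mono hPQ)

/-- The end of a nontrivial chain of links is a frozen corner. [folklore] -/
theorem IsFrozenCorner.of_reflTransGen {P : Set (Site 2)} {a b : Site 2} (ha : IsFrozenCorner Λ P a)
    (h : ReflTransGen (BLink Λ P) a b) : IsFrozenCorner Λ P b := by
  induction h with
  | refl => exact ha
  | tail _ hbc _ =>
    obtain ⟨-, hc, p, hp, i, j, -, hj⟩ := hbc
    exact ⟨hc, p, hp, j, hj⟩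

/-- **The Kadanoff–Ceva primitive is constant along chains of links** (from
`IsKCPrimitive.hw_eq_of_frozen_corners`). [cite: ChelkakHonglerIzyurovAnnals2015, Prop. 3.6 (ii)] -/
theorem IsKCPrimitive.hw_eq_of_reflTransGen_bLink {G₂ : SimpleGraph (Site 2)} [G₂.LocallyFinite] {β : ℝ}
    {η : SpinConfig (Site 2)} {B : Finset (Site 2)} {cut : Site 2 → Finset (Sym2 (Site 2))} {Hw Hb : Site 2 → ℝ}
    {P : Set (Site 2)} (h : IsKCPrimitive G₂ Λ β (.fixed η) B cut Hw Hb P) {a b : Site 2}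
    (hab : ReflTransGen (BLink Λ P) a b) : Hw b = Hw a := by
  induction hab with
  | refl => rfl
  | tail _ hcd ih =>
    obtain ⟨hc, hd, p, hp, i, j, rfl, rfl⟩ := hcd
    rw [← ih]
    exact h.hw_eq_of_frozen_corners (k := i) (k' := j) (by rwa [faceAt_add_cornerOff])
      (by rw [faceAt_add_cornerOff, faceAt_add_cornerOff]) hc hd

end Links

/-! ### Timár's parity argument: frozen corners of touching plaquettes are linked -/

section Touch

variable {Λ : Finset (Site 2)}

/-- The bonds from `Λ` into the sites of `T` outside `Λ`. [cite: Timar2013, Lemma 1 (the set `E₂`)] -/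
def bondsInto (Λ : Finset (Site 2)) (T : Site 2 → Prop) : Finset (Sym2 (Site 2)) :=
  open scoped Classical in
  ((Λ ×ˢ (Finset.univ : Finset (Fin 4))).filter fun q => q.1 + cornerUnit q.2 ∉ Λ ∧ T (q.1 + cornerUnit q.2)).image
    fun q => s(q.1, q.1 + cornerUnit q.2)

/-- Membership of a pair in `bondsInto`. [folklore] -/
theorem mk_mem_bondsInto_iff {T : Site 2 → Prop} {a b : Site 2} :
    s(a, b) ∈ bondsInto Λ T ↔ (zdGraph 2).Adj a b ∧ ((a ∈ Λ ∧ b ∉ Λ ∧ T b) ∨ (b ∈ Λ ∧ a ∉ Λ ∧ T a)) := by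
  classical
  simp only [bondsInto, Finset.mem_image, Finset.mem_filter, Finset.mem_product, Finset.mem_univ, and_true,
    Prod.exists]
  constructor
  · rintro ⟨u, k, ⟨hu, hk, hT⟩, he⟩
    rcases Sym2.eq_iff.1 he with ⟨rfl, rfl⟩ | ⟨rfl, rfl⟩
    · exact ⟨(cSrc_mem_edgeSet (u, k) : (zdGraph 2).Adj u (u + cornerUnit k)), Or.inl ⟨hu, hk, hT⟩⟩
    · exact ⟨(cSrc_mem_edgeSet (u, k) : (zdGraph 2).Adj u (u + cornerUnit k)).symm, Or.inr ⟨hu, hk, hT⟩⟩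
  · rintro ⟨hadj, ⟨ha, hb, hT⟩ | ⟨hb, ha, hT⟩⟩
    · obtain ⟨k, rfl⟩ := WeakBeurling.exists_eq_add_cornerUnit_of_adj hadj
      exact ⟨a, k, ⟨ha, hb, hT⟩, rfl⟩
    · obtain ⟨k, rfl⟩ := WeakBeurling.exists_eq_add_cornerUnit_of_adj hadj.symm
      exact ⟨b, k, ⟨hb, ha, hT⟩, Sym2.eq_swap⟩

/-- Every bond of `bondsInto` has an endpoint in `Λ` and one in `T` outside `Λ`. [folklore] -/
theorem exists_of_mem_bondsInto {T : Site 2 → Prop} {e : Sym2 (Site 2)} (he : e ∈ bondsInto Λ T) :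
    ∃ u w, e = s(u, w) ∧ u ∈ Λ ∧ w ∉ Λ ∧ T w := by
  induction e using Sym2.ind with
  | h a b =>
    rcases (mk_mem_bondsInto_iff.1 he).2 with ⟨ha, hb, hT⟩ | ⟨hb, ha, hT⟩
    · exact ⟨a, b, rfl, ha, hb, hT⟩
    · exact ⟨b, a, Sym2.eq_swap, hb, ha, hT⟩

/-- **A unit square meets `bondsInto Λ T` in an even number of bonds** whenever `T` does not separate
frozen corners of a plaquette touching `Λ`. [cite: Timar2013, proof of Theorem 2] -/
theorem not_odd_card_unitSq_inter_bondsInto {T : Site 2 → Prop}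
    (hT : ∀ p ∈ touchPlaquettes Λ, ∀ i j : Fin 4, p + cornerOff i ∉ Λ → p + cornerOff j ∉ Λ →
      T (p + cornerOff i) → T (p + cornerOff j))
    (p : Site 2) : ¬ Odd #(unitSq p ∩ bondsInto Λ T) := by
  set E := bondsInto Λ T with hE
  -- the four sides, and the parity of the trace as an iterated exclusive or
  have hpar : Odd #(unitSq p ∩ E) ↔
      (s(p, p + ex) ∈ E ↔ ¬ (s(p + ex, p + ex + ey) ∈ E ↔ ¬ (s(p + ex + ey, p + ey) ∈ E ↔ ¬ (s(p + ey, p) ∈ E)))) := by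
    change Odd #((({s(p, p + ex)} : Finset _) ∆ (({s(p + ex, p + ex + ey)} : Finset _) ∆
      (({s(p + ex + ey, p + ey)} : Finset _) ∆ (({s(p + ey, p)} : Finset _) ∆ ∅)))) ∩ E) ↔ _
    rw [odd_card_symmDiff_inter, odd_card_singleton_inter, odd_card_symmDiff_inter, odd_card_singleton_inter,
      odd_card_symmDiff_inter, odd_card_singleton_inter, odd_card_symmDiff_inter, odd_card_singleton_inter]
    simp
  rw [hpar]
  -- the corners `c₀ = p, c₁ = p + e₀, c₂ = p + e₀ + e₁, c₃ = p + e₁`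
  have hc0 : p + cornerOff 0 = p := by simp [cornerOff]
  have hc1 : p + cornerOff 1 = p + ex := by simp [cornerOff]
  have hc2 : p + cornerOff 2 = p + ex + ey := by simp [cornerOff, add_assoc]
  have hc3 : p + cornerOff 3 = p + ey := by simp [cornerOff]
  have a01 : (zdGraph 2).Adj p (p + ex) := (zdGraph_adj_iff _ _).2 ⟨0, Or.inl rfl⟩
  have a12 : (zdGraph 2).Adj (p + ex) (p + ex + ey) := (zdGraph_adj_iff _ _).2 ⟨1, Or.inl rfl⟩
  have a23 : (zdGraph 2).Adj (p + ex + ey) (p + ey) := (zdGraph_adj_iff _ _).2 ⟨0, Or.inr (by rw [add_right_comm])⟩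
  have a30 : (zdGraph 2).Adj (p + ey) p := (zdGraph_adj_iff _ _).2 ⟨1, Or.inr rfl⟩
  simp only [hE, mk_mem_bondsInto_iff, a01, a12, a23, a30, true_and]
  by_cases htouch : p ∈ touchPlaquettes Λ
  · -- all corners outside `Λ` have the same `T`-value `t`
    set t : Prop := ∃ i : Fin 4, p + cornerOff i ∉ Λ ∧ T (p + cornerOff i) with ht
    have key : ∀ i : Fin 4, p + cornerOff i ∉ Λ → (T (p + cornerOff i) ↔ t) := fun i hi =>
      ⟨fun h => ⟨i, hi, h⟩, fun ⟨j, hj, hTj⟩ => hT p htouch j i hj hi hTj⟩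
    have k0 := key 0; have k1 := key 1; have k2 := key 2; have k3 := key 3
    rw [hc0] at k0; rw [hc1] at k1; rw [hc2] at k2; rw [hc3] at k3
    by_cases A0 : p ∈ Λ <;> by_cases A1 : p + ex ∈ Λ <;> by_cases A2 : p + ex + ey ∈ Λ <;>
      by_cases A3 : p + ey ∈ Λ <;> by_cases tt : t <;> simp_all
  · -- no corner in `Λ`: no bond of `E` among the sides
    rw [mem_touchPlaquettes_iff_corner] at htouch
    push Not at htouch
    have A0 := htouch 0; have A1 := htouch 1; have A2 := htouch 2; have A3 := htouch 3
    rw [hc0] at A0; rw [hc1] at A1; rw [hc2] at A2; rw [hc3] at A3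
    simp [A0, A1, A2, A3]

/-- **A frozen corner of a touching plaquette is linked to the outer end of a boundary bond**: there
are `u ∈ Λ` and `w ∉ Λ` adjacent, with `w` linked to `v` (or equal to it). [cite: Timar2013, proof of Theorem 2] -/
theorem exists_boundaryBond_of_isFrozenCorner {v : Site 2} (hv : IsFrozenCorner Λ ↑(touchPlaquettes Λ) v) :
    ∃ u ∈ Λ, ∃ w, (zdGraph 2).Adj u w ∧ w ∉ Λ ∧ ReflTransGen (BLink Λ ↑(touchPlaquettes Λ)) v w := by
  obtain ⟨hvΛ, p, hp, k, rfl⟩ := hv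
  have hp' := hp
  rw [Finset.mem_coe, mem_touchPlaquettes_iff_corner] at hp'
  obtain ⟨j, hj⟩ := hp'
  obtain ⟨i, hi, hi'⟩ := exists_transition_fin4 (m := fun i => p + cornerOff i ∈ Λ) hj hvΛ
  refine ⟨p + cornerOff i, hi, p + cornerOff (i + 1), ?_, hi', ReflTransGen.single ⟨hvΛ, hi', p, hp, k, i + 1, rfl, rfl⟩⟩
  rw [add_cornerOff_succ]
  exact (cSrc_mem_edgeSet (_, i) : (zdGraph 2).Adj _ _)

/-- **Timár's theorem for the frozen boundary (touching plaquettes).** If the free sites `Λ` and their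
complement both induce preconnected subgraphs of `ℤ²`, any two frozen corners of plaquettes touching
`Λ` are joined by a chain of links through plaquettes touching `Λ`. [cite: Timar2013, Lemma 1 and Theorem 2] -/
theorem reflTransGen_bLink_touch (hΛ : ((zdGraph 2).induce (↑Λ : Set (Site 2))).Preconnected)
    (hΛc : ((zdGraph 2).induce (↑Λ : Set (Site 2))ᶜ).Preconnected) {v₁ v₂ : Site 2}
    (hv₁ : IsFrozenCorner Λ ↑(touchPlaquettes Λ) v₁) (hv₂ : IsFrozenCorner Λ ↑(touchPlaquettes Λ) v₂) :
    ReflTransGen (BLink Λ ↑(touchPlaquettes Λ)) v₂ v₁ := by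
  classical
  set Tt : Set (Site 2) := ↑(touchPlaquettes Λ) with hTt
  by_contra hnot
  -- the class of `v₂`
  set T : Site 2 → Prop := fun w => ReflTransGen (BLink Λ Tt) v₂ w with hTdef
  have hT2 : T v₂ := ReflTransGen.refl
  have hT1 : ¬ T v₁ := hnot
  have hTclosed : ∀ p ∈ touchPlaquettes Λ, ∀ i j : Fin 4, p + cornerOff i ∉ Λ → p + cornerOff j ∉ Λ →
      T (p + cornerOff i) → T (p + cornerOff j) :=
    fun p hp i j hi hj hTi => ReflTransGen.tail hTi ⟨hi, hj, p, hp, i, j, rfl, rfl⟩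
  -- boundary bonds `u₁ w₁` (class of `v₁`) and `u₂ w₂` (class of `v₂`)
  obtain ⟨u₁, hu₁, w₁, hadj₁, hw₁, hvw₁⟩ := exists_boundaryBond_of_isFrozenCorner hv₁
  obtain ⟨u₂, hu₂, w₂, hadj₂, hw₂, hvw₂⟩ := exists_boundaryBond_of_isFrozenCorner hv₂
  have hTw₂ : T w₂ := hvw₂
  have hTw₁ : ¬ T w₁ := fun h => hT1 (h.trans (reflTransGen_bLink_symm hvw₁))
  -- the even edge set `Z = {w₁u₁} + (w₁ ⇝ w₂ off Λ) + {w₂u₂} + (u₂ ⇝ u₁ in Λ)`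
  obtain ⟨WX, hWX⟩ := exists_walk_support_subset hΛc (x := w₁) (y := w₂) hw₁ hw₂
  obtain ⟨WΛ, hWΛ⟩ := exists_walk_support_subset hΛ (x := u₂) (y := u₁) hu₂ hu₁
  let P₁ : (zdGraph 2).Walk w₁ u₁ := Walk.cons hadj₁.symm Walk.nil
  let P₂ : (zdGraph 2).Walk w₁ u₁ := WX.append (Walk.cons hadj₂.symm WΛ)
  set Z : Finset (Sym2 (Site 2)) := P₁.edgeParity ∆ P₂.edgeParity with hZ
  have hne : w₁ ≠ u₁ := fun h => hw₁ (h ▸ hu₁)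
  have hZeul : IsEulerian Z := by
    intro v hv
    rw [hZ, oddDeg_symmDiff_iff, oddDeg_edgeParity_iff, oddDeg_edgeParity_iff] at hv
    tauto
  have hZedge : ∀ e ∈ Z, e ∈ (zdGraph 2).edgeSet := by
    intro e he
    rw [hZ, Finset.mem_symmDiff] at he
    rcases he with ⟨he, -⟩ | ⟨he, -⟩
    · exact Walk.edges_subset_edgeSet _ (mem_edges_of_mem_edgeParity _ he)
    · exact Walk.edges_subset_edgeSet _ (mem_edges_of_mem_edgeParity _ he)
  obtain ⟨S, hS⟩ := exists_eq_xorSum_unitSq Z hZedge hZeul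
  -- `E₂` = bonds from `Λ` into the class `T`; it meets every unit square evenly, hence `Z` evenly
  set E := bondsInto Λ T with hE
  have heven : ¬ Odd #(Z ∩ E) := by
    rw [hS]
    exact even_card_xorSum_inter unitSq E S fun i _ => not_odd_card_unitSq_inter_bondsInto hTclosed i
  -- but `Z ∩ E₂ = {w₂u₂}`
  have hnotX : ∀ e ∈ E, e ∉ WX.edges := by
    intro e he heW
    obtain ⟨u, w, rfl, hu, -, -⟩ := exists_of_mem_bondsInto he
    exact hWX u (Walk.fst_mem_support_of_mem_edges _ heW) hu
  have hnotΛ : ∀ e ∈ E, e ∉ WΛ.edges := by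
    intro e he heW
    obtain ⟨u, w, rfl, -, hw, -⟩ := exists_of_mem_bondsInto he
    exact hw (hWΛ w (Walk.snd_mem_support_of_mem_edges _ heW))
  have h1 : s(u₁, w₁) ∉ E := by
    intro h
    rcases (mk_mem_bondsInto_iff.1 h).2 with ⟨-, -, hT⟩ | ⟨hw, -, -⟩
    · exact hTw₁ hT
    · exact hw₁ hw
  have h2 : s(u₂, w₂) ∈ E := mk_mem_bondsInto_iff.2 ⟨hadj₂, Or.inl ⟨hu₂, hw₂, hTw₂⟩⟩
  have hP₁ : P₁.edgeParity = {s(w₁, u₁)} := by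
    change ({s(w₁, u₁)} : Finset (Sym2 (Site 2))) ∆ ∅ = _
    simp
  have hP₂ : P₂.edgeParity = WX.edgeParity ∆ (({s(w₂, u₂)} : Finset (Sym2 (Site 2))) ∆ WΛ.edgeParity) := by
    rw [edgeParity_append]; rfl
  have hZE : Z ∩ E = {s(u₂, w₂)} := by
    ext e
    rw [Finset.mem_inter, Finset.mem_singleton, hZ, Finset.mem_symmDiff, hP₁, hP₂, Finset.mem_singleton,
      Finset.mem_symmDiff, Finset.mem_symmDiff, Finset.mem_singleton]
    constructor
    · rintro ⟨hmem, he⟩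
      have hx : e ∉ WX.edgeParity := fun h => hnotX e he (mem_edges_of_mem_edgeParity _ h)
      have hl : e ∉ WΛ.edgeParity := fun h => hnotΛ e he (mem_edges_of_mem_edgeParity _ h)
      have hne1 : e ≠ s(w₁, u₁) := by rintro rfl; exact h1 (by rw [Sym2.eq_swap]; exact he)
      rw [Sym2.eq_swap (a := u₂)]
      tauto
    · rintro rfl
      have he : s(u₂, w₂) ∈ E := h2
      have hx : s(u₂, w₂) ∉ WX.edgeParity := fun h => hnotX _ he (mem_edges_of_mem_edgeParity _ h)
      have hl : s(u₂, w₂) ∉ WΛ.edgeParity := fun h => hnotΛ _ he (mem_edges_of_mem_edgeParity _ h)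
      have hne1 : s(u₂, w₂) ≠ s(w₁, u₁) := by intro h; rw [h, Sym2.eq_swap] at he; exact h1 he
      have hsw : s(u₂, w₂) = s(w₂, u₂) := Sym2.eq_swap
      refine ⟨?_, he⟩
      tauto
  apply heven
  rw [hZE, Finset.card_singleton]
  exact odd_one

/-- The same with the two ends in either order. [cite: Timar2013, Theorem 2] -/
theorem reflTransGen_bLink_touch' (hΛ : ((zdGraph 2).induce (↑Λ : Set (Site 2))).Preconnected)
    (hΛc : ((zdGraph 2).induce (↑Λ : Set (Site 2))ᶜ).Preconnected) {v₁ v₂ : Site 2}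
    (hv₁ : IsFrozenCorner Λ ↑(touchPlaquettes Λ) v₁) (hv₂ : IsFrozenCorner Λ ↑(touchPlaquettes Λ) v₂) :
    ReflTransGen (BLink Λ ↑(touchPlaquettes Λ)) v₁ v₂ :=
  reflTransGen_bLink_touch hΛ hΛc hv₂ hv₁

end Touch

/-! ### Frozen corners of the filled plaquette set -/

section Fill

variable {Λ : Finset (Site 2)}

/-- `cornerOff 3` is the unit vector `e₁`. [folklore] -/
theorem cornerOff_three : cornerOff 3 = ey := rfl

/-- A filled plaquette which does not touch `Λ` has the plaquette above it filled as well.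
[cite: Smirnov2010, §3 (simply connected lattice domains)] -/
theorem add_ey_mem_fillFinset {q : Site 2} (hq : q ∈ fillFinset (touchPlaquettes Λ)) (hqt : q ∉ touchPlaquettes Λ)
    (hqt' : q + ey ∉ touchPlaquettes Λ) : q + ey ∈ fillFinset (touchPlaquettes Λ) := by
  rw [mem_fillFinset_iff] at hq ⊢
  refine Or.inr fun hesc => ?_
  rcases hq with hq | hq
  · exact hqt hq
  · refine hq (hesc.of_reflTransGen (ReflTransGen.single ⟨?_, ?_, ?_⟩))
    · exact (zdGraph_adj_iff _ _).2 ⟨1, Or.inl rfl⟩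
    · exact fun h => hqt h
    · exact fun h => hqt' h

/-- **Straight up from a filled plaquette one reaches a touching plaquette**, through filled
non-touching plaquettes. [cite: Smirnov2010, §3] -/
theorem exists_touch_above {q : Site 2} (hq : q ∈ fillFinset (touchPlaquettes Λ)) :
    ∃ n : ℕ, q + n • ey ∈ touchPlaquettes Λ ∧
      ∀ m < n, q + m • ey ∈ fillFinset (touchPlaquettes Λ) ∧ q + m • ey ∉ touchPlaquettes Λ := by
  classical
  -- heights of filled plaquettes are bounded
  obtain ⟨M, hM⟩ : ∃ M : ℤ, ∀ g ∈ fillFinset (touchPlaquettes Λ), g 1 ≤ M := by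
    refine ⟨((fillFinset (touchPlaquettes Λ)).image fun g : Site 2 => g 1).sup' ⟨q 1, Finset.mem_image_of_mem _ hq⟩ id,
      fun g hg => ?_⟩
    exact Finset.le_sup' (f := id) (Finset.mem_image_of_mem (fun g : Site 2 => g 1) hg)
  have hey1 : ∀ n : ℕ, (q + n • ey) 1 = q 1 + n := fun n => by simp [Pi.add_apply]
  have hex : ∃ n : ℕ, q + n • ey ∈ touchPlaquettes Λ ∨ q + n • ey ∉ fillFinset (touchPlaquettes Λ) := by
    refine ⟨(M - q 1).toNat + 1, Or.inr fun h => ?_⟩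
    have h1 := hM _ h
    rw [hey1] at h1
    push_cast at h1
    omega
  have hmin : ∀ m < Nat.find hex, q + m • ey ∈ fillFinset (touchPlaquettes Λ) ∧ q + m • ey ∉ touchPlaquettes Λ := by
    intro m hm
    have := Nat.find_min hex hm
    tauto
  refine ⟨Nat.find hex, ?_, hmin⟩
  rcases Nat.find_spec hex with h | h
  · exact h
  · by_cases ht : q + Nat.find hex • ey ∈ touchPlaquettes Λ
    · exact ht
    exfalso
    obtain ⟨m, hm⟩ : ∃ m, Nat.find hex = m + 1 := by
      refine Nat.exists_eq_add_one_of_ne_zero fun h0 => ?_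
      rw [h0, zero_smul, add_zero] at h
      exact h hq
    have hm' := hmin m (by rw [hm]; exact Nat.lt_succ_self m)
    rw [hm, add_smul, one_smul, ← add_assoc] at h ht
    exact h (add_ey_mem_fillFinset hm'.1 hm'.2 ht)

/-- **Every frozen corner of the filled plaquette set is linked, through filled plaquettes, to a
frozen corner of a touching plaquette.** [cite: ChelkakHonglerIzyurovAnnals2015, Prop. 3.6 (ii)] -/
theorem exists_reflTransGen_bLink_fill_touch {v : Site 2} (hv : IsFrozenCorner Λ ↑(fillFinset (touchPlaquettes Λ)) v) :
    ∃ w, IsFrozenCorner Λ ↑(touchPlaquettes Λ) w ∧ ReflTransGen (BLink Λ ↑(fillFinset (touchPlaquettes Λ))) v w := by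
  obtain ⟨hvΛ, q, hq, k₀, rfl⟩ := hv
  rw [Finset.mem_coe] at hq
  obtain ⟨n, hn, hbelow⟩ := exists_touch_above hq
  rcases Nat.eq_zero_or_pos n with rfl | hnpos
  · rw [zero_smul, add_zero] at hn
    exact ⟨_, ⟨hvΛ, q, hn, k₀, rfl⟩, ReflTransGen.refl⟩
  -- no corner of `q + m • ey`, `m < n`, is in `Λ`
  have hfree : ∀ m < n, ∀ i : Fin 4, q + m • ey + cornerOff i ∉ Λ := fun m hm i hi =>
    (hbelow m hm).2 (mem_touchPlaquettes_iff_corner.2 ⟨i, hi⟩)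
  -- climb: `v ⇝ q + m • ey` for `1 ≤ m ≤ n`
  have hclimb : ∀ m : ℕ, 1 ≤ m → m ≤ n →
      ReflTransGen (BLink Λ ↑(fillFinset (touchPlaquettes Λ))) (q + cornerOff k₀) (q + m • ey) := by
    intro m hm1 hmn
    induction m with
    | zero => omega
    | succ m ih =>
      have hstep : BLink Λ ↑(fillFinset (touchPlaquettes Λ)) (q + m • ey + cornerOff 0) (q + (m + 1) • ey) := by
        refine ⟨by exact hfree m (by omega) 0, ?_, q + m • ey, (hbelow m (by omega)).1, 0, 3, rfl, ?_⟩
        · have := hfree m (by omega) 3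
          rwa [cornerOff_three, add_assoc, ← succ_nsmul] at this
        · rw [cornerOff_three, add_smul, one_smul, add_assoc]
      have h0 : q + m • ey + cornerOff 0 = q + m • ey := by simp [cornerOff]
      rw [h0] at hstep
      rcases Nat.eq_zero_or_pos m with rfl | hmpos
      · -- first step from `v` through `q` itself
        have hq0 : q ∈ fillFinset (touchPlaquettes Λ) := by simpa using (hbelow 0 hnpos).1
        refine ReflTransGen.single ⟨hvΛ, ?_, q, hq0, k₀, 3, rfl, ?_⟩
        · have := hfree 0 hnpos 3
          simpa [cornerOff_three] using this
        · simp [cornerOff_three]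
      · exact (ih (by omega) (by omega)).tail hstep
  refine ⟨q + n • ey, ⟨?_, q + n • ey, hn, 0, by simp [cornerOff]⟩, hclimb n hnpos le_rfl⟩
  obtain ⟨m, rfl⟩ : ∃ m, n = m + 1 := Nat.exists_eq_add_one_of_ne_zero (by omega)
  have := hfree m (by omega) 3
  rwa [cornerOff_three, add_assoc, ← succ_nsmul] at this

/-- **Timár's theorem for the frozen boundary (filled plaquette set).** If `Λ` and its complement
induce preconnected subgraphs of `ℤ²`, any two frozen corners of the filled set of plaquettes
touching `Λ` — the plaquette set of `exists_kcCuts_primitive` — are joined by a chain of links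
through its plaquettes. [cite: Timar2013, Theorem 2; ChelkakHonglerIzyurovAnnals2015, Prop. 3.6 (ii)] -/
theorem reflTransGen_bLink_fill (hΛ : ((zdGraph 2).induce (↑Λ : Set (Site 2))).Preconnected)
    (hΛc : ((zdGraph 2).induce (↑Λ : Set (Site 2))ᶜ).Preconnected) {v₁ v₂ : Site 2}
    (hv₁ : IsFrozenCorner Λ ↑(fillFinset (touchPlaquettes Λ)) v₁)
    (hv₂ : IsFrozenCorner Λ ↑(fillFinset (touchPlaquettes Λ)) v₂) :
    ReflTransGen (BLink Λ ↑(fillFinset (touchPlaquettes Λ))) v₁ v₂ := by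
  obtain ⟨w₁, hw₁, h₁⟩ := exists_reflTransGen_bLink_fill_touch hv₁
  obtain ⟨w₂, hw₂, h₂⟩ := exists_reflTransGen_bLink_fill_touch hv₂
  have hsub : (↑(touchPlaquettes Λ) : Set (Site 2)) ⊆ ↑(fillFinset (touchPlaquettes Λ)) :=
    Finset.coe_subset.2 (subset_fillFinset _)
  exact (h₁.trans (reflTransGen_bLink_mono hsub (reflTransGen_bLink_touch' hΛ hΛc hw₁ hw₂))).trans
    (reflTransGen_bLink_symm h₂)

/-- **Global Dirichlet normalisation of the Kadanoff–Ceva primitive** (Chelkak–Hongler–Izyurov 2015,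
Prop. 3.6 (ii): "`H°` vanishes on the boundary"): for a connected, simply connected set of free sites
(`Λ` and `ℤ² ∖ Λ` lattice-preconnected), the primitive `Hw` of an admissible cut system on the filled
set of plaquettes touching `Λ` takes the same value at all frozen corners of its plaquettes.
[cite: ChelkakHonglerIzyurovAnnals2015, Prop. 3.6 (ii)] -/
theorem IsKCPrimitive.hw_eq_of_preconnected {G₂ : SimpleGraph (Site 2)} [G₂.LocallyFinite] {β : ℝ}
    {η : SpinConfig (Site 2)} {B : Finset (Site 2)} {cut : Site 2 → Finset (Sym2 (Site 2))} {Hw Hb : Site 2 → ℝ}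
    (h : IsKCPrimitive G₂ Λ β (.fixed η) B cut Hw Hb ↑(fillFinset (touchPlaquettes Λ)))
    (hΛ : ((zdGraph 2).induce (↑Λ : Set (Site 2))).Preconnected)
    (hΛc : ((zdGraph 2).induce (↑Λ : Set (Site 2))ᶜ).Preconnected)
    {v v' : Site 2} {k k' : Fin 4} (hv : v ∉ Λ) (hk : faceAt v k ∈ fillFinset (touchPlaquettes Λ))
    (hv' : v' ∉ Λ) (hk' : faceAt v' k' ∈ fillFinset (touchPlaquettes Λ)) : Hw v' = Hw v :=
  h.hw_eq_of_reflTransGen_bLink (reflTransGen_bLink_fill hΛ hΛc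
    ⟨hv, faceAt v k, hk, k, ((faceAt_eq_iff).1 rfl)⟩ ⟨hv', faceAt v' k', hk', k', ((faceAt_eq_iff).1 rfl)⟩)

/-- The same for a cut system on the touching plaquettes themselves. [cite: ChelkakHonglerIzyurovAnnals2015, Prop. 3.6 (ii)] -/
theorem IsKCPrimitive.hw_eq_of_preconnected_touch {G₂ : SimpleGraph (Site 2)} [G₂.LocallyFinite] {β : ℝ}
    {η : SpinConfig (Site 2)} {B : Finset (Site 2)} {cut : Site 2 → Finset (Sym2 (Site 2))} {Hw Hb : Site 2 → ℝ}
    (h : IsKCPrimitive G₂ Λ β (.fixed η) B cut Hw Hb ↑(touchPlaquettes Λ))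
    (hΛ : ((zdGraph 2).induce (↑Λ : Set (Site 2))).Preconnected)
    (hΛc : ((zdGraph 2).induce (↑Λ : Set (Site 2))ᶜ).Preconnected)
    {v v' : Site 2} {k k' : Fin 4} (hv : v ∉ Λ) (hk : faceAt v k ∈ touchPlaquettes Λ)
    (hv' : v' ∉ Λ) (hk' : faceAt v' k' ∈ touchPlaquettes Λ) : Hw v' = Hw v :=
  h.hw_eq_of_reflTransGen_bLink (reflTransGen_bLink_touch' hΛ hΛc
    ⟨hv, faceAt v k, hk, k, ((faceAt_eq_iff).1 rfl)⟩ ⟨hv', faceAt v' k', hk', k', ((faceAt_eq_iff).1 rfl)⟩)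

end Fill

/-! ### The complement of a finite hole-free set is lattice-preconnected -/

section HoleFreeCompl

variable {Λ : Finset (Site 2)}

/-- Face-step chains off `Λ` are walks in the subgraph of `ℤ²` induced on the complement. [folklore] -/
theorem reachable_induce_compl_of_reflTransGen {x y : Site 2} (hx : x ∉ Λ) (hy : y ∉ Λ)
    (h : ReflTransGen (FaceStep (↑Λ : Set (Site 2))) x y) :
    ((zdGraph 2).induce (↑Λ : Set (Site 2))ᶜ).Reachable ⟨x, hx⟩ ⟨y, hy⟩ := by
  induction h with
  | refl => exact Reachable.refl _
  | @tail b c _ hbc ih =>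
    have hb : b ∉ Λ := fun h => hbc.2.1 h
    exact (ih hb).trans (Adj.reachable (by simpa [SimpleGraph.comap_adj] using hbc.1))

/-- Coordinates after `n` steps east. [folklore] -/
theorem nsmul_cornerUnit_zero_apply (s : Site 2) (n : ℕ) :
    (s + n • cornerUnit 0) 0 = s 0 + n ∧ (s + n • cornerUnit 0) 1 = s 1 := by
  simp [Pi.add_apply, cornerUnit]

/-- Coordinates after `n` steps west. [folklore] -/
theorem nsmul_cornerUnit_two_apply (s : Site 2) (n : ℕ) :
    (s + n • cornerUnit 2) 0 = s 0 - n ∧ (s + n • cornerUnit 2) 1 = s 1 := by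
  simp [Pi.add_apply, cornerUnit, sub_eq_add_neg]

/-- **The complement of a finite hole-free set of sites induces a preconnected subgraph of `ℤ²`**:
two sites off `Λ` escape above `Λ` and are joined there. [cite: Smirnov2010, §3 (simply connected lattice domains)] -/
theorem induce_compl_preconnected_of_holeFree (hΛ : HoleFree (↑Λ : Set (Site 2))) :
    ((zdGraph 2).induce (↑Λ : Set (Site 2))ᶜ).Preconnected := by
  classical
  -- a strict upper bound for the heights of `Λ`
  obtain ⟨M, hM⟩ : ∃ M : ℤ, ∀ g ∈ Λ, g 1 < M := by
    rcases Λ.eq_empty_or_nonempty with h | h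
    · exact ⟨0, by simp [h]⟩
    · refine ⟨(Λ.image fun g : Site 2 => g 1).sup' (h.image _) id + 1, fun g hg => ?_⟩
      have := Finset.le_sup' (f := id) (Finset.mem_image_of_mem (fun g : Site 2 => g 1) hg)
      exact Int.lt_add_one_iff.2 this
  have habove : ∀ g : Site 2, M ≤ g 1 → g ∉ (↑Λ : Set (Site 2)) := fun g hg hmem => by
    have := hM g hmem; omega
  -- from a site of height `≥ M`: straight up, and sideways, one stays off `Λ`
  have hup : ∀ g : Site 2, M ≤ g 1 → ∀ n : ℕ, ReflTransGen (FaceStep (↑Λ : Set (Site 2))) g (g + n • cornerUnit 1) := by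
    intro g hg n
    refine reflTransGen_faceStep_line 1 (fun n => habove _ ?_) n
    rw [(nsmul_cornerUnit_one_apply g n).2]; omega
  have hside0 : ∀ g : Site 2, M ≤ g 1 → ∀ n : ℕ, ReflTransGen (FaceStep (↑Λ : Set (Site 2))) g (g + n • cornerUnit 0) := by
    intro g hg n
    refine reflTransGen_faceStep_line 0 (fun n => habove _ ?_) n
    rw [(nsmul_cornerUnit_zero_apply g n).2]; exact hg
  have hside2 : ∀ g : Site 2, M ≤ g 1 → ∀ n : ℕ, ReflTransGen (FaceStep (↑Λ : Set (Site 2))) g (g + n • cornerUnit 2) := by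
    intro g hg n
    refine reflTransGen_faceStep_line 2 (fun n => habove _ ?_) n
    rw [(nsmul_cornerUnit_two_apply g n).2]; exact hg
  -- main argument
  rintro ⟨x, hx⟩ ⟨y, hy⟩
  have hx' : x ∉ Λ := hx
  have hy' : y ∉ Λ := hy
  obtain ⟨gx, hgx, hxg⟩ := hΛ x hx' M
  obtain ⟨gy, hgy, hyg⟩ := hΛ y hy' M
  -- lift both to the common height `K = max`, then move horizontally
  set K : ℤ := max (gx 1) (gy 1) with hK
  set gx' : Site 2 := gx + (K - gx 1).toNat • cornerUnit 1 with hgx'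
  set gy' : Site 2 := gy + (K - gy 1).toNat • cornerUnit 1 with hgy'
  have hgx'1 : gx' 1 = K := by
    rw [hgx', (nsmul_cornerUnit_one_apply gx _).2, Int.toNat_of_nonneg (by omega)]; omega
  have hgy'1 : gy' 1 = K := by
    rw [hgy', (nsmul_cornerUnit_one_apply gy _).2, Int.toNat_of_nonneg (by omega)]; omega
  have hgx'0 : gx' 0 = gx 0 := by rw [hgx', (nsmul_cornerUnit_one_apply gx _).1]
  have hgy'0 : gy' 0 = gy 0 := by rw [hgy', (nsmul_cornerUnit_one_apply gy _).1]
  have hKM : M ≤ K := le_trans hgx (le_max_left _ _)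
  -- horizontal move from `gx'` to `gy'`
  have hhor : ReflTransGen (FaceStep (↑Λ : Set (Site 2))) gx' gy' := by
    rcases le_or_gt (gx 0) (gy 0) with hle | hgt
    · have := hside0 gx' (by omega) (gy 0 - gx 0).toNat
      convert this using 1
      refine Site.eq_iff_two.2 ⟨?_, ?_⟩
      · rw [(nsmul_cornerUnit_zero_apply gx' _).1, hgx'0, hgy'0, Int.toNat_of_nonneg (by omega)]; omega
      · rw [(nsmul_cornerUnit_zero_apply gx' _).2, hgx'1, hgy'1]
    · have := hside2 gx' (by omega) (gx 0 - gy 0).toNat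
      convert this using 1
      refine Site.eq_iff_two.2 ⟨?_, ?_⟩
      · rw [(nsmul_cornerUnit_two_apply gx' _).1, hgx'0, hgy'0, Int.toNat_of_nonneg (by omega)]; omega
      · rw [(nsmul_cornerUnit_two_apply gx' _).2, hgx'1, hgy'1]
  have hchain : ReflTransGen (FaceStep (↑Λ : Set (Site 2))) x y :=
    (((hxg.trans (hup gx hgx _)).trans hhor).trans (reflTransGen_faceStep_symm (hup gy hgy _))).trans
      (reflTransGen_faceStep_symm hyg)
  exact reachable_induce_compl_of_reflTransGen hx' hy' hchain

end HoleFreeCompl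

end Literature.Probability.LatticeModels
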